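import Summits.BirchSwinnertonDyer.BirchSwinnertonDyer.Theorems.GenusKolyvaginAtTwoPowDvdShaCardAtTwoRTLevelTwoAuxiliary
import HarnessLib

/-!
# Route `CMKolyvaginAtInertTwo`, crux `CMKolyvaginExactAtInertTwo` (stmt-BirchSwinnertonDyer-24277), `stub_lower` — W-UP on H₂,
# FILE W2: THE LEVEL-`2` AUXILIARY CLASS WITH DEEP OWN PRIMES — free on `S`, zero on `D`, in a prescribed local condition `M_u`
# (`#M_u ≥ 2`) on `t`, Kummer elsewhere — exists as soon as `∏_{u∈D} #H¹(ℚ_u, E[2]) ≤ 4^{#S}` and the dual structure is non-zero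

Seat `bsd-line-cmk2-p1` g19 (cell `bsd-print-cf2`), `--supports stmt-BirchSwinnertonDyer-24277` (helper; closes nothing).
THEOREMS ONLY (no definition, no named fact, no `sorry`).  BSD is NOT proved by any of this; the crux is not closed here.

WHY.  gk2 LEAD g16's `RelaxedCount.exists_ne_zero_levelTwoAuxiliary` (`…RTLevelTwoAuxiliary`) gives the level-`2` auxiliary `y` of the
all-Gross prime swap (memo `Lines/plus-descent-lead-g16.md` §3) for the structure «free on `S`, zero on `D`, Kummer elsewhere».  The
`k`-minimal primitive product of the W-UP loop also has DEEP own primes `t` (index `≥ 2`), where the swapped Kolyvagin class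
`Z = desc c₁(nℓ′)` is transverse and NOT zero; there `y` must lie in a local condition `M_u` orthogonal to the transverse localisations
(file W1, `#M_u ≥ 2`).  THIS FILE re-runs the LEAD's count with such a third set `t`: Wiles' formula in gk2's squared product form
(`natCard_solutions_sq_mul_prod_eq_kummerOutside`) reads `#𝒴² · 4^{#S} · ∏_D #H¹_u · 4^{#t} = (4^{#S} · ∏_t #M_u)² · #𝒴*²`, and
`#M_u ≥ 2` makes the `t`-places neutral: a non-zero `y ∈ 𝒴` exists when `∏_D #H¹_u ≤ 4^{#S}` and `𝒴* ∋ b ≠ 0` (Kummer off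
`S ∪ D ∪ t`, ZERO on `S`, in `{}^⊥M_u` on `t`, free on `D` — the descended Kolyvagin class of the `k`-minimal product).
* `exists_ne_zero_levelTwoAuxiliary_deep` (Weil-pairing datum displayed, canonical Poitou–Tate family, `T = S ∪ D ∪ t`).

References: [McCallumLMS1991] §2 Prop. 2.1, §5 proof of Prop. 5.2; [MilneADT2006] Ch. I Thm. 2.8, Thm. 4.10; [Kramer1981] Prop. 3.
-/

set_option autoImplicit false
-- the Theorems namespace of this sub repeats the summit name by design (D-0017 nested layout)
set_option linter.dupNamespace false

noncomputable section

open scoped Classical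

open CategoryTheory Field NumberField IsDedekindDomain Function
open _root_.WeierstrassCurve
open Literature.NumberTheory.EllipticCurves
open Literature.NumberTheory.GaloisRepresentations
open Literature.NumberTheory.GaloisCohomology
open Summit.BirchSwinnertonDyer.Rank1Residual.X11b.KummerPT
open Summit.BirchSwinnertonDyer.Rank1Residual.X11b.FiniteDuality
open Summit.BirchSwinnertonDyer.Rank1Residual.X11b.Relaxation
open Summit.BirchSwinnertonDyer.Rank1Residual.X11b.LocBridge Summit.BirchSwinnertonDyer.Rank1Residual.X11b.Levels
open Summit.BirchSwinnertonDyer.Rank1Residual.X11b.AcSelmer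
open scoped ContRepresentation

namespace Summit.BirchSwinnertonDyer.BirchSwinnertonDyer.Theorems.KolyvaginLowerTwo

open Summit.BirchSwinnertonDyer.BirchSwinnertonDyer.Theorems.GenusKolyKramer (finite_galoisCohomology_toLocal)
open Summit.BirchSwinnertonDyer.BirchSwinnertonDyer.Theorems.GenusExact
open Summit.BirchSwinnertonDyer.BirchSwinnertonDyer.Theorems.GenusExact.AuxiliaryClass
open Summit.BirchSwinnertonDyer.BirchSwinnertonDyer.Theorems.GenusExact.RelaxedCount

variable (W : WeierstrassCurve ℚ) [W.IsElliptic] [W.IsGloballyMinimal]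
variable (e : geomTorsion W ((2 ^ 1 : ℕ) : ℤ) → geomTorsion W ((2 ^ 1 : ℕ) : ℤ) → AlgebraicClosure ℚ)
  (hμ : ∀ S T, e S T ^ (2 ^ 1) = 1)
  (hadd₁ : ∀ S₁ S₂ T, e (S₁ + S₂) T = e S₁ T * e S₂ T)
  (hadd₂ : ∀ S T₁ T₂, e S (T₁ + T₂) = e S T₁ * e S T₂)
  (hgal : ∀ (σ : absoluteGaloisGroup ℚ) (S T : geomTorsion W ((2 ^ 1 : ℕ) : ℤ)), σ • e S T = e (σ • S) (σ • T))
  (halt : ∀ T, e T T = 1) (hnondeg : ∀ T, (∀ S, e S T = 1) → T = 0)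

include halt hnondeg in
/-- **THE LEVEL-2 AUXILIARY WITH DEEP OWN PRIMES.**  `E/ℚ` globally minimal with `Δ < 0`; `S`, `D`, `t` pairwise disjoint finite sets
of places, `S ∪ t` at Gross–Kolyvagin primes (`ℓ ≠ 2` good, `Frob_ℓ = Frob_∞` on `E[2]`, index `≥ 1`, so `#H¹(ℚ_ℓ, E[2]) = 4`);
`M_u ≤ H¹(ℚ_u, E[2])` with `2 ≤ #M_u` for `u ∈ t`; the canonical Poitou–Tate family and a displayed Weil pairing at level `2`.  If
`∏_{u∈D} #H¹(ℚ_u, E[2]) ≤ 4^{#S}` and some `b ≠ 0` is Kummer off `S ∪ D ∪ t`, ZERO on `S` and in `{}^⊥M_u` on `t`, then there is a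
non-zero `y`, Kummer off `S ∪ D ∪ t`, ZERO on `D`, with `loc_u y ∈ M_u` on `t` (and free on `S`).
[cite: McCallumLMS1991, §2 Prop. 2.1 and §5 proof of Prop. 5.2] [cite: MilneADT2006, Ch. I, Thm. 4.10] [cite: Kramer1981, Prop. 3] -/
theorem exists_ne_zero_levelTwoAuxiliary_deep (hΔ : W.Δ < 0) {K : Type} [Field K] [NumberField K]
    (S D t : Finset (Place ℚ)) (hSD : Disjoint S D) (hSt : Disjoint S t) (hDt : Disjoint D t)
    (hSK : ∀ u ∈ S ∪ t, ∃ (v : HeightOneSpectrum (𝓞 ℚ)) (ℓ : ℕ) (_ : Fact ℓ.Prime), u = Sum.inr v ∧ ℓ ≠ 2 ∧ (ℓ : 𝓞 ℚ) ∈ v.asIdeal ∧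
      W.HasGoodReductionAtPrime ℓ ∧ FrobEqFrobInfty W K 2 ℓ ∧ 1 ≤ Zhang2014.kolyvaginIndex W 2 ℓ)
    (Mt : ∀ u : Place ℚ, AddSubgroup (galoisCohomology ((W.torsionGaloisModule ((2 ^ 1 : ℕ) : ℤ)).toLocal u) 1))
    (hMt : ∀ u ∈ t, 2 ≤ Nat.card (Mt u))
    (hδ : ∏ u ∈ D, Nat.card (galoisCohomology ((W.torsionGaloisModule ((2 ^ 1 : ℕ) : ℤ)).toLocal u) 1) ≤ 4 ^ S.card)
    {b : galoisCohomology (W.torsionGaloisModule ((2 ^ 1 : ℕ) : ℤ)) 1} (hbT : b ∈ kummerOutside W (2 ^ 1) (S ∪ D ∪ t))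
    (hbS : ∀ u ∈ S, galoisCohomology.localization (W.torsionGaloisModule ((2 ^ 1 : ℕ) : ℤ)) u 1 b = 0)
    (hbt : ∀ u ∈ t, galoisCohomology.localization (W.torsionGaloisModule ((2 ^ 1 : ℕ) : ℤ)) u 1 b ∈
      annLeft (invWeilPairing W (2 ^ 1) e hμ hadd₁ hadd₂ hgal (LocalInvariants.canonical ℚ (2 ^ 1)) u) (Mt u))
    (hb : b ≠ 0) :
    ∃ y ∈ kummerOutside W (2 ^ 1) (S ∪ D ∪ t),
      (∀ u ∈ D, galoisCohomology.localization (W.torsionGaloisModule ((2 ^ 1 : ℕ) : ℤ)) u 1 y = 0) ∧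
      (∀ u ∈ t, galoisCohomology.localization (W.torsionGaloisModule ((2 ^ 1 : ℕ) : ℤ)) u 1 y ∈ Mt u) ∧ y ≠ 0 := by
  haveI : Fact (Nat.Prime 2) := ⟨Nat.prime_two⟩
  haveI hfin : ∀ u : Place ℚ, Finite (galoisCohomology ((W.torsionGaloisModule ((2 ^ 1 : ℕ) : ℤ)).toLocal u) 1) :=
    fun u ↦ finite_galoisCohomology_toLocal W (2 ^ 1) u
  haveI : Finite (W.geomTorsion ((2 ^ 1 : ℕ) : ℤ)) := finite_geomTorsion_pow W 2 1
  set T : Finset (Place ℚ) := S ∪ D ∪ t with hTdef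
  -- disjointness bookkeeping
  have hSD' : ∀ u ∈ S, u ∉ D := fun u hu ↦ Finset.disjoint_left.mp hSD hu
  have hSt' : ∀ u ∈ t, u ∉ S := fun u hu ↦ Finset.disjoint_right.mp hSt hu
  have hDt' : ∀ u ∈ t, u ∉ D := fun u hu ↦ Finset.disjoint_right.mp hDt hu
  have hDS' : ∀ u ∈ D, u ∉ S := fun u hu ↦ Finset.disjoint_right.mp hSD hu
  -- the canonical inputs
  have hpp : IsPrimePow (2 ^ 1) := ⟨2, 1, Nat.prime_two.prime, one_pos, rfl⟩
  have hperf := LocalInvariants.canonical_isPerfect (K := ℚ) (n := 2 ^ 1)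
  have hsum := Summit.BirchSwinnertonDyer.BirchSwinnertonDyer.Theorems.SchneiderFreeAdditiveX3.PoitouTateReduction.sumLocalTermEqZero_canonical
    (K := ℚ) (2 ^ 1)
  have hcompl := Summit.BirchSwinnertonDyer.BirchSwinnertonDyer.Theorems.SchneiderFreeAdditiveX3.PoitouTateReduction.selmerComplement_canonical_holds
    ℚ (2 ^ 1)
  have hreal : ∀ w' : InfinitePlace ℚ, w'.IsReal →
      Injective (LocalInvariants.canonical ℚ (2 ^ 1) (Sum.inl w')) := fun w' hw' ↦ by
    rw [LocalInvariants.canonical_inl]; exact archimedeanInvariantMap_injective_of_isReal hw'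
  have hEuler : ∀ v : HeightOneSpectrum (𝓞 ℚ),
      Nat.card (galoisCohomology ((W.torsionGaloisModule ((2 ^ 1 : ℕ) : ℤ)).toLocal (Sum.inr v)) 1) =
        (Nat.card (nsmulAddMonoidHom (2 ^ 1) :
            (W.baseChange (v.adicCompletion ℚ)).toAffine.Point →+ _).ker *
          Nat.card (v.adicCompletionIntegers ℚ ⧸
            Ideal.span {((2 ^ 1 : ℕ) : v.adicCompletionIntegers ℚ)})) ^ 2 := fun v ↦ by
    haveI : CharZero (v.adicCompletion ℚ) := charZero_adicCompletion v
    exact natCard_galoisCohomology_one_torsion_adicCompletion_eq_sq W v (2 ^ 1) hpp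
      (localEulerPoincareCharacteristic_holds (v.adicCompletion ℚ))
  -- product localisation and the local conditions `⊤` on `S`, `⊥` on `D`, `M_u` on `t`
  set loc : galoisCohomology (W.torsionGaloisModule ((2 ^ 1 : ℕ) : ℤ)) 1 →+
      (∀ u : ↥T, galoisCohomology ((W.torsionGaloisModule ((2 ^ 1 : ℕ) : ℤ)).toLocal (u : Place ℚ)) 1) :=
    AddMonoidHom.pi fun u ↦ galoisCohomology.localization (W.torsionGaloisModule ((2 ^ 1 : ℕ) : ℤ)) (u : Place ℚ) 1 with hlocd
  have hloc : ∀ c u, loc c u = galoisCohomology.localization (W.torsionGaloisModule ((2 ^ 1 : ℕ) : ℤ)) (u : Place ℚ) 1 c :=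
    fun c u ↦ rfl
  set M : ∀ u : ↥T, AddSubgroup (galoisCohomology ((W.torsionGaloisModule ((2 ^ 1 : ℕ) : ℤ)).toLocal (u : Place ℚ)) 1) :=
    fun u ↦ if (u : Place ℚ) ∈ S then ⊤ else if (u : Place ℚ) ∈ D then ⊥ else Mt u with hMdef
  set Y := kummerOutside W (2 ^ 1) T ⊓ (AddSubgroup.pi Set.univ M).comap loc with hYdef
  set Y' := kummerOutside W (2 ^ 1) T ⊓ (AddSubgroup.pi Set.univ (fun u : ↥T ↦
    annLeft (invWeilPairing W (2 ^ 1) e hμ hadd₁ hadd₂ hgal (LocalInvariants.canonical ℚ (2 ^ 1)) (u : Place ℚ)) (M u))).comap loc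
    with hY'def
  -- the squared count
  have hcount := natCard_solutions_sq_mul_prod_eq_kummerOutside W 2 1 e hμ hadd₁ hadd₂ hgal halt hnondeg hperf hsum hcompl hEuler
    hreal T loc hloc M
  rw [← hYdef, ← hY'def] at hcount
  -- finiteness
  have hfinKO : Finite (kummerOutside W (2 ^ 1) T) :=
    Summit.BirchSwinnertonDyer.Rank1Residual.X11b.SelmerLevelBound.finite_kummerOutside W (2 ^ 1) T
  haveI : Finite Y := Finite.of_injective _ (AddSubgroup.inclusion_injective (inf_le_left : Y ≤ _))
  haveI : Finite Y' := Finite.of_injective _ (AddSubgroup.inclusion_injective (inf_le_left : Y' ≤ _))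
  -- `b ∈ Y*`, so `#Y* ≥ 2`
  have hbY' : b ∈ Y' := by
    rw [hY'def]
    refine AddSubgroup.mem_inf.mpr ⟨hbT, ?_⟩
    rw [AddSubgroup.mem_comap, AddSubgroup.mem_pi]
    intro u _
    rw [hloc, hMdef]
    by_cases huS : (u : Place ℚ) ∈ S
    · simp only [huS, if_true]
      rw [hbS u huS]
      exact zero_mem _
    · by_cases huD : (u : Place ℚ) ∈ D
      · simp only [huS, if_false, huD, if_true]
        rw [mem_annLeft_iff]
        intro m hm
        rw [AddSubgroup.mem_bot] at hm
        rw [hm, map_zero]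
      · simp only [huS, if_false, huD]
        have hut : (u : Place ℚ) ∈ t := by
          have hu : (u : Place ℚ) ∈ S ∪ D ∪ t := u.2
          rw [Finset.mem_union, Finset.mem_union] at hu
          rcases hu with (h | h) | h
          · exact absurd h huS
          · exact absurd h huD
          · exact h
        exact hbt u hut
  have h2 : 2 ≤ Nat.card Y' := by
    have h1 : 1 < Nat.card Y' :=
      Finite.one_lt_card_iff_nontrivial.mpr ⟨⟨⟨b, hbY'⟩, 0, fun h ↦ hb (congrArg Subtype.val h)⟩⟩
    omega
  -- local counts: `#H¹_u = 4` on `S ∪ t`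
  have hcard4 : ∀ u ∈ S ∪ t, Nat.card (galoisCohomology ((W.torsionGaloisModule ((2 ^ 1 : ℕ) : ℤ)).toLocal u) 1) = 4 := by
    intro u hu
    obtain ⟨v, ℓ, hℓp, huv, hℓ2, hv, hgood, hFrob, hidx⟩ := hSK u hu
    rw [huv, natCard_galoisCohomology_one_toLocal_two_pow_eq W hΔ hℓ2 hgood hFrob hv one_ne_zero hidx, pow_one]
  -- `∏_{v∈T} #H¹_v = 4^{#S} · P_D · 4^{#t}`
  have hSDt : Disjoint (S ∪ D) t := Finset.disjoint_union_left.mpr ⟨hSt, hDt⟩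
  have hGsplit : ∏ v ∈ T, Nat.card (galoisCohomology ((W.torsionGaloisModule ((2 ^ 1 : ℕ) : ℤ)).toLocal v) 1) =
      4 ^ S.card * (∏ u ∈ D, Nat.card (galoisCohomology ((W.torsionGaloisModule ((2 ^ 1 : ℕ) : ℤ)).toLocal u) 1)) *
        4 ^ t.card := by
    rw [hTdef, Finset.prod_union hSDt, Finset.prod_union hSD,
      Finset.prod_congr rfl fun u hu ↦ hcard4 u (Finset.mem_union_left t hu), Finset.prod_const,
      Finset.prod_congr rfl fun u hu ↦ hcard4 u (Finset.mem_union_right S hu), Finset.prod_const]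
  -- `∏_u #M_u = 4^{#S} · ∏_{u∈t} #M_u`
  set f : Place ℚ → ℕ := fun v ↦ if v ∈ S then Nat.card (galoisCohomology ((W.torsionGaloisModule ((2 ^ 1 : ℕ) : ℤ)).toLocal v) 1)
    else if v ∈ D then 1 else Nat.card (Mt v) with hfdef
  have hMu : ∀ u : ↥T, Nat.card (M u) = f u := by
    intro u
    rw [hMdef, hfdef]
    by_cases hu : (u : Place ℚ) ∈ S
    · simp only [hu, if_true]; exact AddSubgroup.card_top
    · by_cases huD : (u : Place ℚ) ∈ D
      · simp only [hu, if_false, huD, if_true]; exact AddSubgroup.card_bot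
      · simp only [hu, if_false, huD]
  have hM : (∏ u : ↥T, Nat.card (M u)) = 4 ^ S.card * ∏ u ∈ t, Nat.card (Mt u) := by
    rw [Finset.prod_congr rfl fun u _ ↦ hMu u, Finset.prod_coe_sort T f, hTdef, Finset.prod_union hSDt,
      Finset.prod_union hSD]
    have hS1 : ∏ v ∈ S, f v = 4 ^ S.card := by
      rw [Finset.prod_congr rfl fun u hu ↦ ?_, Finset.prod_const]
      rw [hfdef]
      simp only [hu, if_true]
      exact hcard4 u (Finset.mem_union_left t hu)
    have hD1 : ∏ v ∈ D, f v = 1 := Finset.prod_eq_one fun v hv ↦ by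
      rw [hfdef]; simp only [hDS' v hv, if_false, hv, if_true]
    have ht1 : ∏ v ∈ t, f v = ∏ u ∈ t, Nat.card (Mt u) := Finset.prod_congr rfl fun v hv ↦ by
      rw [hfdef]; simp only [hSt' v hv, if_false, hDt' v hv]
    rw [hS1, hD1, ht1, mul_one]
  -- `∏_{u∈t} #M_u ≥ 2^{#t}`, so its square is `≥ 4^{#t}`
  have hmt : 2 ^ t.card ≤ ∏ u ∈ t, Nat.card (Mt u) := Finset.pow_card_le_prod t (fun u ↦ Nat.card (Mt u)) 2 hMt
  have hmt2 : 4 ^ t.card ≤ (∏ u ∈ t, Nat.card (Mt u)) ^ 2 := by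
    have h := Nat.pow_le_pow_left hmt 2
    rw [← pow_mul] at h
    calc 4 ^ t.card = 2 ^ (t.card * 2) := by rw [mul_comm, pow_mul]; norm_num
      _ ≤ _ := h
  rw [hGsplit, hM] at hcount
  -- `#Y ≥ 2`
  have hY2 : 2 ≤ Nat.card Y := by
    by_contra hlt
    push Not at hlt
    have hYpos : 0 < Nat.card Y := Nat.card_pos
    have hY1 : Nat.card Y = 1 := by omega
    rw [hY1, one_pow, one_mul] at hcount
    set A := 4 ^ S.card with hA
    set Bt := 4 ^ t.card with hBt
    set P := ∏ u ∈ D, Nat.card (galoisCohomology ((W.torsionGaloisModule ((2 ^ 1 : ℕ) : ℤ)).toLocal u) 1) with hP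
    set m := ∏ u ∈ t, Nat.card (Mt u) with hm
    have hApos : 0 < A := pow_pos (by norm_num) _
    have hBpos : 0 < Bt := pow_pos (by norm_num) _
    have hy4 : 4 ≤ Nat.card Y' ^ 2 := by nlinarith
    -- `A·P·Bt = (A·m)²·#Y*² ≥ A²·Bt·4`
    have hge : A * A * Bt * 4 ≤ A * P * Bt := by
      calc A * A * Bt * 4 ≤ A * A * m ^ 2 * Nat.card Y' ^ 2 := by
            have := Nat.mul_le_mul (Nat.mul_le_mul_left (A * A) hmt2) hy4
            linarith
        _ = (A * m) ^ 2 * Nat.card Y' ^ 2 := by ring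
        _ = A * P * Bt := hcount.symm
    -- cancel `A · Bt`
    have hP4 : A * 4 ≤ P := by
      have h1 : A * 4 * (A * Bt) ≤ P * (A * Bt) := by
        calc A * 4 * (A * Bt) = A * A * Bt * 4 := by ring
          _ ≤ A * P * Bt := hge
          _ = P * (A * Bt) := by ring
      exact Nat.le_of_mul_le_mul_right h1 (Nat.mul_pos hApos hBpos)
    -- contradiction with `P ≤ A`
    have : A * 4 ≤ A := hP4.trans hδ
    omega
  -- a non-zero element of `Y`
  haveI : Nontrivial Y := Finite.one_lt_card_iff_nontrivial.mp (by omega)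
  obtain ⟨⟨y, hyY⟩, hy⟩ := exists_ne (0 : Y)
  have hy0 : y ≠ 0 := fun h ↦ hy (Subtype.ext h)
  rw [hYdef] at hyY
  obtain ⟨hyT, hyM⟩ := AddSubgroup.mem_inf.mp hyY
  rw [AddSubgroup.mem_comap, AddSubgroup.mem_pi] at hyM
  refine ⟨y, hyT, fun u hu ↦ ?_, fun u hu ↦ ?_, hy0⟩
  · have huT : u ∈ T := by rw [hTdef]; exact Finset.mem_union_left t (Finset.mem_union_right S hu)
    have h1 := hyM ⟨u, huT⟩ (Set.mem_univ _)
    rw [hMdef] at h1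
    simp only [hDS' u hu, if_false, hu, if_true, AddSubgroup.mem_bot] at h1
    exact h1
  · have huT : u ∈ T := by rw [hTdef]; exact Finset.mem_union_right _ hu
    have h1 := hyM ⟨u, huT⟩ (Set.mem_univ _)
    rw [hMdef] at h1
    simp only [hSt' u hu, if_false, hDt' u hu] at h1
    exact h1

end Summit.BirchSwinnertonDyer.BirchSwinnertonDyer.Theorems.KolyvaginLowerTwo

end
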